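import Mathlib
import Summits.ValiantsHypothesis.ValiantsHypothesis.Theorems.GrenetZeonTwoDimCoefficientsScalingUnitriangularPointHessian

/-!
# Crux `GrenetZeon.TwoDimCoefficients` (stmt-ValiantsHypothesis-8062) / rung `DualUnipotentThreeHalves` (stmt-24318):
# scaling-closure — PG(k ≤ n/2): EVERY SUBSPACE OF `M_n(ℂ)` OF CODIMENSION `≤ n/2` CONTAINS A FULL-RANK POINT OF `Hess per_n`

The per-genericity theorem of the T4 programme (memo NINETEENTH-HAND.md §3) in the range where it holds with FULL rank: the
Hessian-degeneracy locus `{z : rank Hess per_n(z) < n²}` of the permanent contains no linear subspace of codimension `≤ n/2`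
(`n ≥ 2`).  The order is right up to the constant: the König subspace `{row i = 0}` has codimension `n` and Hessian rank `≤ 2n`
everywhere.  Consequence for T4 (✓ p836227): an index-reducing substitution of corank `κ ≤ n/2` needs NO per-genericity clause.

Proof.  (i) `exists_cells_sup_span_eq_top`: a subspace `V` of codimension `k` is supplemented by the coordinate lines of some
`≤ k` cells `S` (induction on the gap).  (ii) `exists_perm_lt_of_card` / sorting: a row order `ρ` putting the `≤ k` rows of `S`
first and a column order `κ` putting the `≤ k` columns of `S` last make every cell of `S` strictly upper (`ρ r < κ c`) as soon
as `2k ≤ n`.  (iii) Write the permutation point `P_{τ₀}` (`τ₀ = ρ⁻¹κ`, the diagonal `ρ r = κ c`) as `v + u`, `v ∈ V`, `u`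
supported on `S`; then `v = P_{τ₀} − u` is a UNITRIANGULAR point for `(ρ, κ)` and ✓ `rank_hess0_transl_unitri_perPoly` (p837494)
gives `rank Hess per_n(v) = n²`.

* `exists_cells_sup_span_eq_top`, `eq_zero_of_mem_span_single`, `exists_perm_lt_of_card` — the three lemmas above;
* ★★★ `exists_mem_fullRank_hess0_perPoly_of_codim_le_half` — `∀ V ≤ M_n(ℂ)`, `codim V = k`, `2k ≤ n` ⇒ `∃ z ∈ V`,
  `rank Hess per_n(z) = n²`.

HONEST FRAMING: an unconditional, route-independent theorem about the permanent (no Theses import).  It discharges the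
per-genericity clause of T4 for substitutions of corank `≤ n/2` only; INDEX-COST (corank up to `n²/4`), PG-weak beyond `n/2`,
the stub `DualUnipotentBound`, crux 8062, the 24318 decl and `VP ≠ VNP` remain open.

References: T. Mignon, N. Ressayre, Int. Math. Res. Not. 2004:79, §3 (via the tree); folklore.
-/

-- single-conjunct layout `Summits/ValiantsHypothesis/ValiantsHypothesis`: the duplicated namespace
-- component is mandated by the tree.
set_option linter.dupNamespace false
set_option autoImplicit false

noncomputable section

namespace Summit.ValiantsHypothesis.ValiantsHypothesis.Theorems.GrenetZeonTwoDimCoefficients.ScalingClosure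

open MvPolynomial Matrix
open Literature.Computability.AlgebraicComplexity

section CodimHalf

variable {n : ℕ}

/-- (i) **Supplementing cells.**  A subspace `V` of `X → ℂ` (`X` finite) whose dimension gap is `≤ g` is supplemented by the
coordinate lines of at most `g` cells: `V ⊔ span {e_p : p ∈ S} = ⊤`, `|S| ≤ g`. [folklore] -/
theorem exists_cells_sup_span_eq_top {X : Type*} [Fintype X] [DecidableEq X] :
    ∀ (g : ℕ) (V : Submodule ℂ (X → ℂ)), Fintype.card X ≤ Module.finrank ℂ V + g →
      ∃ S : Finset X, S.card ≤ g ∧ V ⊔ Submodule.span ℂ ((fun p : X => (Pi.single p (1 : ℂ) : X → ℂ)) '' ↑S) = ⊤ := by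
  intro g
  induction g with
  | zero =>
    intro V hV
    refine ⟨∅, le_rfl, ?_⟩
    have hVtop : V = ⊤ := by
      apply Submodule.eq_top_of_finrank_eq
      rw [Module.finrank_fintype_fun_eq_card]
      have := Submodule.finrank_le V
      rw [Module.finrank_fintype_fun_eq_card] at this
      omega
    rw [hVtop, top_sup_eq]
  | succ g ih =>
    intro V hV
    by_cases hVtop : V = ⊤
    · exact ⟨∅, Nat.zero_le _, by rw [hVtop, top_sup_eq]⟩
    · -- some coordinate vector lies outside `V`
      obtain ⟨p, hp⟩ : ∃ p : X, (Pi.single p (1 : ℂ) : X → ℂ) ∉ V := by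
        by_contra h
        push Not at h
        apply hVtop
        rw [eq_top_iff, ← (Pi.basisFun ℂ X).span_eq, Submodule.span_le]
        rintro _ ⟨q, rfl⟩
        rw [Pi.basisFun_apply]
        exact h q
      set V' := V ⊔ Submodule.span ℂ {(Pi.single p (1 : ℂ) : X → ℂ)} with hV'
      have hlt : V < V' := by
        refine lt_of_le_of_ne le_sup_left fun heq => hp ?_
        rw [heq, hV']
        exact Submodule.mem_sup_right (Submodule.subset_span rfl)
      have hdim : Fintype.card X ≤ Module.finrank ℂ V' + g := by
        have := Submodule.finrank_lt_finrank_of_lt hlt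
        omega
      obtain ⟨S', hS'card, hS'⟩ := ih V' hdim
      refine ⟨insert p S', (Finset.card_insert_le _ _).trans (by omega), ?_⟩
      rw [eq_top_iff, ← hS', hV', sup_assoc]
      refine sup_le_sup_left ?_ V
      refine sup_le ?_ ?_
      · apply Submodule.span_mono
        rintro _ rfl
        exact ⟨p, Finset.mem_insert_self _ _, rfl⟩
      · apply Submodule.span_mono
        rintro _ ⟨q, hq, rfl⟩
        exact ⟨q, Finset.mem_insert_of_mem hq, rfl⟩

/-- A vector in the span of the coordinate vectors of `S` vanishes off `S`. [folklore] -/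
theorem eq_zero_of_mem_span_single {X : Type*} [DecidableEq X] (S : Finset X) {u : X → ℂ}
    (hu : u ∈ Submodule.span ℂ ((fun p : X => (Pi.single p (1 : ℂ) : X → ℂ)) '' ↑S)) {q : X} (hq : q ∉ S) :
    u q = 0 := by
  induction hu using Submodule.span_induction with
  | mem x hx =>
    obtain ⟨p, hp, rfl⟩ := hx
    dsimp only
    rw [Pi.single_apply, if_neg]
    rintro rfl
    exact hq hp
  | zero => rfl
  | add x y _ _ hx hy => rw [Pi.add_apply, hx, hy, add_zero]
  | smul a x _ hx => rw [Pi.smul_apply, hx, smul_zero]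

/-- (ii) **Sorting a set of rows to the front.**  For `R ⊆ Fin n` there is a permutation `ρ` with `ρ r < |R|` for all `r ∈ R`
(sort the indicator of `Rᶜ`). [folklore] -/
theorem exists_perm_lt_of_card (R : Finset (Fin n)) : ∃ ρ : Equiv.Perm (Fin n), ∀ r ∈ R, (ρ r).val < R.card := by
  classical
  set f : Fin n → ℕ := fun r => if r ∈ R then 0 else 1 with hf
  set σ := Tuple.sort f with hσ
  have hmono : Monotone (f ∘ σ) := Tuple.monotone_sort f
  refine ⟨σ⁻¹, fun r hr => ?_⟩
  by_contra hge
  push Not at hge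
  -- the positions `≤ σ⁻¹ r` all carry rows of `R`
  have hzero : ∀ i : Fin n, i ≤ σ⁻¹ r → σ i ∈ R := by
    intro i hi
    have h := hmono hi
    simp only [Function.comp_apply] at h
    have hσr : σ (σ⁻¹ r) = r := σ.apply_symm_apply r
    have hr0 : f (σ (σ⁻¹ r)) = 0 := by
      rw [hσr, hf]
      dsimp only
      rw [if_pos hr]
    rw [hr0] at h
    by_contra hni
    have : f (σ i) = 1 := by rw [hf]; dsimp only; rw [if_neg hni]
    omega
  -- so `R` has more than `|R|` elements
  have hcard : (Finset.univ.filter fun i : Fin n => i ≤ σ⁻¹ r).card ≤ R.card := by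
    refine Finset.card_le_card_of_injOn σ (fun i hi => ?_) (Set.injOn_of_injective σ.injective)
    rw [Finset.coe_filter] at hi
    exact hzero i hi.2
  have hcount : (σ⁻¹ r).val + 1 ≤ (Finset.univ.filter fun i : Fin n => i ≤ σ⁻¹ r).card := by
    have : (Finset.univ.filter fun i : Fin n => i ≤ σ⁻¹ r) = Finset.Iic (σ⁻¹ r) := by
      ext i; simp
    rw [this, Fin.card_Iic]
  omega

/-- ★★★ **PG(k ≤ n/2): every linear subspace of `M_n(ℂ)` of codimension `k ≤ n/2` contains a point at which the Hessian of
`per_n` has full rank `n²`** (`n ≥ 2`).  The König subspaces `{row i = 0}` (codimension `n`, Hessian rank `≤ 2n`) show the range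
is right up to the constant. [cite: MignonRessayre2004, §3 — via the tree; folklore] -/
theorem exists_mem_fullRank_hess0_perPoly_of_codim_le_half (hn : 2 ≤ n) (V : Submodule ℂ (Fin n × Fin n → ℂ)) (k : ℕ)
    (hV : n ^ 2 ≤ Module.finrank ℂ V + k) (hk : 2 * k ≤ n) :
    ∃ z ∈ V, (hess0 (transl z (perPoly (Fin n) ℂ))).rank = n ^ 2 := by
  classical
  -- (i) supplementing cells
  obtain ⟨S, hScard, hS⟩ := exists_cells_sup_span_eq_top (X := Fin n × Fin n) k V
    (by rw [Fintype.card_prod, Fintype.card_fin, ← sq]; exact hV)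
  -- (ii) orders: rows of `S` first, columns of `S` last
  set R : Finset (Fin n) := S.image Prod.fst with hR
  set C : Finset (Fin n) := S.image Prod.snd with hC
  have hRcard : R.card ≤ k := (Finset.card_image_le).trans hScard
  have hCcard : C.card ≤ k := (Finset.card_image_le).trans hScard
  obtain ⟨ρ, hρ⟩ := exists_perm_lt_of_card R
  obtain ⟨κ', hκ'⟩ := exists_perm_lt_of_card C
  -- reverse the column positions: `κ c = n - 1 - κ' c`
  set κ : Equiv.Perm (Fin n) := κ'.trans Fin.revPerm with hκdef
  have hκ : ∀ c, (κ c).val = n - 1 - (κ' c).val := fun c => by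
    rw [hκdef, Equiv.trans_apply, Fin.revPerm_apply, Fin.val_rev]
    omega
  have hSU : ∀ p ∈ S, (ρ p.1).val < (κ p.2).val := by
    intro p hp
    have h1 := hρ p.1 (Finset.mem_image_of_mem _ hp)
    have h2 := hκ' p.2 (Finset.mem_image_of_mem _ hp)
    have h3 := (κ' p.2).isLt
    rw [hκ]
    omega
  -- (iii) decompose the permutation point `P_{τ₀}`, `τ₀ = ρ⁻¹ κ`
  set P : Fin n × Fin n → ℂ := fun u => if ρ u.1 = κ u.2 then 1 else 0 with hPdef
  have hPmem : P ∈ V ⊔ Submodule.span ℂ ((fun p : Fin n × Fin n => (Pi.single p (1 : ℂ) : _ → ℂ)) '' ↑S) := by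
    rw [hS]; exact Submodule.mem_top
  obtain ⟨v, hv, u, hu, hvu⟩ := Submodule.mem_sup.mp hPmem
  have hu0 : ∀ q ∉ S, u q = 0 := fun q hq => eq_zero_of_mem_span_single S hu hq
  -- `v = P − u` is the unitriangular point with entries `−u` above the diagonal
  have hvz : v = fun q : Fin n × Fin n =>
      if ρ q.1 = κ q.2 then (1 : ℂ) else if (ρ q.1).val < (κ q.2).val then (fun q => -u q) q else 0 := by
    funext q
    have hq : v q = P q - u q := by rw [← hvu]; simp
    rw [hq, hPdef]
    dsimp only
    by_cases h1 : ρ q.1 = κ q.2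
    · -- diagonal cell: not in `S`
      have hqS : q ∉ S := fun hqS => by have := hSU q hqS; rw [h1] at this; exact lt_irrefl _ this
      rw [if_pos h1, if_pos h1, hu0 q hqS, sub_zero]
    · rw [if_neg h1, if_neg h1]
      by_cases h2 : (ρ q.1).val < (κ q.2).val
      · rw [if_pos h2, zero_sub]
      · have hqS : q ∉ S := fun hqS => h2 (hSU q hqS)
        rw [if_neg h2, hu0 q hqS, sub_zero]
  refine ⟨v, hv, ?_⟩
  rw [hvz]
  exact rank_hess0_transl_unitri_perPoly hn ρ κ (fun q => -u q)

end CodimHalf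

end Summit.ValiantsHypothesis.ValiantsHypothesis.Theorems.GrenetZeonTwoDimCoefficients.ScalingClosure

end
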